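/-
Copyright (c) 2026. All rights reserved.
Released under Apache 2.0 license as described in the file LICENSE.
Authors: abc-iut cell, Cor. 3.12 sub-crew seat abc-iut-c312-1 (gen 24).
-/
import Literature.IUT.LogVolume.UnitLogDyadicSqrtNegOne
import Literature.IUT.LogVolume.LogUnitsTraceZeroCoradial
import Mathlib.RingTheory.Trace.Basic
import HarnessLib

/-!
# At `K ≅ ℚ₂(√−1)` the trace-zero part of `log₂(𝒪_K^×) = 𝔪³` is NOT co-radial: it sits one shell below the top
# (classical 2-adic algebra; the named exception of `LogUnitsTraceZeroCoradial`)

abc-iut cell, PROOF-ONLY classical local algebra (Cor. 3.12 sub-crew, seat abc-iut-c312-1 gen 24, row «C:P2-HULL-GAP», file 1/2;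
no definition, no `Prop` fact, no instance, no notation).  Setting: a `2`-adic field `K` in the campaign-S class (nontrivially normed,
normed `ℚ₂`-algebra, ultrametric, proper) containing `i` with `i² = −1`, of invariants `(e, f) = (2, 1)` — i.e. `K ≅ ℚ₂(√−1)`; `ϖ` a
norm uniformizer (`‖ϖ‖² = ‖2‖ = 1/2`).  abc-iut-w4-d017's `DyadicNoFixedBall.logUnits_eq_closedBall_cube_of_sq_eq_neg_one`: there
`log₂(𝒪_K^×) = 𝔪³ = {‖y‖ ≤ ‖ϖ‖³}` IS a ball.

WHY (the consumer, `Summits/ABC/IUTFork/Thm311RealInd1StripHullDyadic`): `LogUnitsTraceZeroCoradial` (p527172) proves that at every TAMELY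
ramified `p`-adic field of degree `≥ 2` the trace-zero sublattice `log_p(𝒪^×) ∩ Ker Tr_{K/ℚ_p}` contains an element of maximal norm of
`log_p(𝒪^×)` (co-radiality), whence the single-place HULL WASHOUT of `Thm311RealInd1StripHull` (p528030); both files name the present field
as the untreated exception («wildly ramified fields NOT treated — co-radiality can fail, e.g. `ℚ₂(√−1)`: `𝔪 ∩ Ker Tr ⊆ 𝔪²`»).  THIS FILE
makes that exception a theorem:

* §1 (any `p`, `[K:ℚ_p] = 2`, `i ∉ ℚ_p·1`) `trace_eq_zero_of_sq_eq_neg_one` — `Tr_{K/ℚ_p}(i) = 0` (left-multiplication matrix of `i` on the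
  basis `(1, i)`: diagonal `(0, 0)`); `ker_trace_eq_span_of_sq_eq_neg_one` — `Ker Tr = ℚ_p·i` (`Tr 1 = 2 ≠ 0`, dimension count);
  `exists_eq_smul_of_trace_eq_zero` — every trace-zero `w` is `b·i`, `b ∈ ℚ_p`, with `‖w‖ = ‖b‖`;
* §2 (`p = 2`, `i² = −1`, so `i ∉ ℚ₂·1` automatically — `algebraMap_ne_of_sq_eq_neg_one`: `‖i − 1‖² = ‖2‖ = 1/2` is not the square of a
  `2`-adic absolute value) and `(e, f) = (2, 1)`: `norm_eq_zpow_two_mul_of_trace_eq_zero` — a non-zero trace-zero element has EVEN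
  `ϖ`-valuation (`‖w‖ = ‖b‖₂ = 2^{−v} = ‖ϖ‖^{2v}`); **`norm_le_zpow_four_of_mem_logUnits_of_trace_eq_zero`** — every trace-zero unit
  logarithm has `‖w‖ ≤ ‖ϖ‖⁴`, ONE SHELL BELOW the top `‖ϖ‖³` of `log₂(𝒪_K^×) = 𝔪³`; `smul_mem_logUnits_trace_eq_zero_norm_eq` — `w₀ = 4·i`
  is a trace-zero unit logarithm with `‖w₀‖ = ‖ϖ‖⁴`; hence `isGreatest_norm_logUnits` (`‖ϖ‖³`, at `ϖ³`) versus
  `isGreatest_norm_logUnits_inter_ker_trace` (`‖ϖ‖⁴` — and `‖ϖ‖⁴ < ‖ϖ‖³`), and the headline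
  **`not_exists_mem_logUnits_trace_eq_zero_isMaxOn`** — NO trace-zero unit logarithm has maximal norm in `log₂(𝒪_K^×)`: the exact negation, at
  `ℚ₂(√−1)`, of the conclusion of `TraceZeroCoradial.exists_mem_logUnits_trace_eq_zero_isMaxOn_of_tame`.
READING (classical; numbers about `ℚ₂(√−1)` only): the radial gap between Dupuy–Hilado's container span `c·log₂(𝒪^×)` and the trace-zero
ceiling direction is exactly one `ϖ`-shell (`[𝔪³ : 𝔪⁴] = 2`) at this field; what that does to hulls of regions is the consumer's business.
HONEST SCOPE: classical; ONE field shape `(e, f) = (2, 1)` with `√−1` (every base field of an initial Θ-datum contains `√−1`, [IUTchI]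
Def. 3.1 (a), so these are exactly the dyadic places of local degree `2` of such fields); the other dyadic shapes (`log₂(𝒪^×)` not a ball,
`UnitLogDyadicSqrtNegOne` §3) are NOT treated; nothing here mentions a hull, a packet or a log-volume; no side taken on [IUTchIII] Cor. 3.12;
NO abc claim. [cite: NeukirchANT1999, Ch. II Prop. (5.5), (5.7)] [cite: SerreLocalFields1979, Ch. III §3, Prop. 7]
-/

set_option autoImplicit false

noncomputable section

open Metric Set Module
open scoped Pointwise

namespace Literature.IUT.LogVolume

namespace TraceZeroDyadicSqrtNegOne

open Literature.NumberTheory.GaloisRepresentations.Ultrametric RamificationCriterion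

/-! ## §1 Degree two with `i² = −1`, `i ∉ ℚ_p·1`: `Tr(i) = 0` and `Ker Tr = ℚ_p·i` (any `p`) -/

section AnyPrime

variable {p : ℕ} [Fact p.Prime]
variable {K : Type*} [NontriviallyNormedField K] [NormedAlgebra ℚ_[p] K]

/-- `‖i‖ = 1` for `i² = −1` (a root of unity is a unit). [cite: NeukirchANT1999, Ch. II Prop. (5.7)] -/
theorem norm_eq_one_of_sq_eq_neg_one {i : K} (hi : i ^ 2 = -1) : ‖i‖ = 1 := by
  have h : ‖i‖ ^ 2 = 1 := by rw [← norm_pow, hi, norm_neg, norm_one]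
  exact (pow_eq_one_iff_of_nonneg (norm_nonneg i) two_ne_zero).mp h

/-- `i ≠ 0` for `i² = −1`. [folklore] -/
private theorem ne_zero_of_sq_eq_neg_one {i : K} (hi : i ^ 2 = -1) : i ≠ 0 := by
  intro h
  rw [h, sq, mul_zero] at hi
  exact one_ne_zero (neg_eq_zero.mp hi.symm)

/-- `(1, i)` is `ℚ_p`-linearly independent as soon as `i ∉ ℚ_p·1`. [folklore] -/
private theorem linearIndependent_one_of_forall_algebraMap_ne {i : K} (hi1 : ∀ a : ℚ_[p], algebraMap ℚ_[p] K a ≠ i) :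
    LinearIndependent ℚ_[p] ![(1 : K), i] := by
  refine LinearIndependent.pair_iff.mpr fun s t hst => ?_
  by_cases ht : t = 0
  · rw [ht, zero_smul, add_zero, Algebra.smul_def, mul_one] at hst
    exact ⟨(map_eq_zero_iff _ (algebraMap ℚ_[p] K).injective).mp hst, ht⟩
  · exfalso
    apply hi1 (-s / t)
    -- `s·1 + t·i = 0` ⟹ `i = (−s/t)·1`
    have h1 : t • i = -(s • (1 : K)) := eq_neg_of_add_eq_zero_right hst
    have h2 : i = t⁻¹ • (-(s • (1 : K))) := by
      rw [← h1, smul_smul, inv_mul_cancel₀ ht, one_smul]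
    rw [h2, smul_neg, ← neg_smul, smul_smul, Algebra.smul_def, mul_one]
    congr 1
    rw [div_eq_mul_inv, mul_comm, mul_neg, neg_mul]

/-- **`Tr_{K/ℚ_p}(i) = 0`** for `[K : ℚ_p] = 2`, `i² = −1`, `i ∉ ℚ_p·1`: on the basis `(1, i)` left multiplication by `i` has matrix
`(0 −1; 1 0)`, whose diagonal vanishes. [cite: SerreLocalFields1979, Ch. III §3] -/
theorem trace_eq_zero_of_sq_eq_neg_one {i : K} (hi : i ^ 2 = -1) (hi1 : ∀ a : ℚ_[p], algebraMap ℚ_[p] K a ≠ i)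
    (hd : finrank ℚ_[p] K = 2) : Algebra.trace ℚ_[p] K i = 0 := by
  classical
  have hli := linearIndependent_one_of_forall_algebraMap_ne hi1
  let b : Basis (Fin 2) ℚ_[p] K := basisOfLinearIndependentOfCardEqFinrank hli (by rw [Fintype.card_fin, hd])
  have hb : ⇑b = ![(1 : K), i] := coe_basisOfLinearIndependentOfCardEqFinrank hli _
  have hb0 : b 0 = 1 := by rw [hb]; rfl
  have hb1 : b 1 = i := by rw [hb]; rfl
  rw [Algebra.trace_eq_matrix_trace b, Matrix.trace_fin_two, Algebra.leftMulMatrix_eq_repr_mul,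
    Algebra.leftMulMatrix_eq_repr_mul, hb0, mul_one, hb1]
  have hii : i * i = -(b 0) := by rw [← sq, hi, hb0]
  rw [hii, map_neg, ← hb1, b.repr_self, b.repr_self, Finsupp.neg_apply, Finsupp.single_apply, Finsupp.single_apply,
    if_neg (show (1 : Fin 2) ≠ 0 by decide), if_neg (show (0 : Fin 2) ≠ 1 by decide), neg_zero, add_zero]

/-- `Tr_{K/ℚ_p}(1) = 2 ≠ 0` at degree `2` (characteristic zero). [folklore] -/
private theorem trace_one_ne_zero (hd : finrank ℚ_[p] K = 2) : Algebra.trace ℚ_[p] K 1 ≠ 0 := by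
  haveI : FiniteDimensional ℚ_[p] K := Module.finite_of_finrank_eq_succ hd
  rw [← map_one (algebraMap ℚ_[p] K), Algebra.trace_algebraMap, hd, nsmul_eq_mul, mul_one]
  exact two_ne_zero

/-- **`Ker Tr_{K/ℚ_p} = ℚ_p·i`** for `[K : ℚ_p] = 2`, `i² = −1`, `i ∉ ℚ_p·1` (`⊇` by `Tr(i) = 0`; both sides have dimension `1` since
`Tr 1 = 2 ≠ 0`). [cite: SerreLocalFields1979, Ch. III §3] -/
theorem ker_trace_eq_span_of_sq_eq_neg_one {i : K} (hi : i ^ 2 = -1) (hi1 : ∀ a : ℚ_[p], algebraMap ℚ_[p] K a ≠ i)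
    (hd : finrank ℚ_[p] K = 2) :
    LinearMap.ker (Algebra.trace ℚ_[p] K) = Submodule.span ℚ_[p] {i} := by
  haveI : FiniteDimensional ℚ_[p] K := Module.finite_of_finrank_eq_succ hd
  set Tr := Algebra.trace ℚ_[p] K with hTr
  have hle : Submodule.span ℚ_[p] {i} ≤ LinearMap.ker Tr := by
    rw [Submodule.span_le, Set.singleton_subset_iff]
    exact (LinearMap.mem_ker).mpr (trace_eq_zero_of_sq_eq_neg_one hi hi1 hd)
  have hTr1 : Tr 1 ≠ 0 := trace_one_ne_zero hd
  have hrangeTr : LinearMap.range Tr = ⊤ := by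
    rw [eq_top_iff]
    intro t _
    refine ⟨(t / Tr 1) • (1 : K), ?_⟩
    rw [map_smul, smul_eq_mul, div_mul_cancel₀ t hTr1]
  have hker : finrank ℚ_[p] (LinearMap.ker Tr) = 1 := by
    have h := LinearMap.finrank_range_add_finrank_ker Tr
    rw [hrangeTr, finrank_top, Module.finrank_self, hd] at h
    omega
  have hspan : finrank ℚ_[p] (Submodule.span ℚ_[p] ({i} : Set K)) = 1 :=
    finrank_span_singleton (ne_zero_of_sq_eq_neg_one hi)
  exact (Submodule.eq_of_le_of_finrank_eq hle (by rw [hspan, hker])).symm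

/-- Every trace-zero element is `b·i` with `b ∈ ℚ_p`, and then `‖w‖ = ‖b‖`. [cite: SerreLocalFields1979, Ch. III §3] -/
theorem exists_eq_smul_of_trace_eq_zero {i : K} (hi : i ^ 2 = -1) (hi1 : ∀ a : ℚ_[p], algebraMap ℚ_[p] K a ≠ i)
    (hd : finrank ℚ_[p] K = 2) {w : K} (hw : Algebra.trace ℚ_[p] K w = 0) :
    ∃ b : ℚ_[p], w = b • i ∧ ‖w‖ = ‖b‖ := by
  have hmem : w ∈ Submodule.span ℚ_[p] ({i} : Set K) := by
    rw [← ker_trace_eq_span_of_sq_eq_neg_one hi hi1 hd]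
    exact (LinearMap.mem_ker).mpr hw
  obtain ⟨b, hb⟩ := Submodule.mem_span_singleton.mp hmem
  exact ⟨b, hb.symm, by rw [← hb, norm_smul, norm_eq_one_of_sq_eq_neg_one hi, mul_one]⟩

end AnyPrime

/-! ## §2 `p = 2`, `(e, f) = (2, 1)`, `i² = −1`: the trace-zero unit logarithms sit one shell below the top of `𝔪³` -/

section Dyadic

variable {K : Type*} [NontriviallyNormedField K] [NormedAlgebra ℚ_[2] K] [IsUltrametricDist K] [ProperSpace K]
  {ϖ : Kˣ} (hϖ : IsUniformizer ϖ)

omit [IsUltrametricDist K] [ProperSpace K] in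
/-- **`i ∉ ℚ₂·1`** for `i² = −1` in a normed `ℚ₂`-algebra: `(i − 1)² = −2i` has norm `1/2`, so `‖i − 1‖² = 1/2`; but for `a ∈ ℚ₂` the norm
`‖a − 1‖` is `0` or an integral power of `2`, whose square is never `1/2`. [cite: NeukirchANT1999, Ch. II Prop. (5.5)] -/
theorem algebraMap_ne_of_sq_eq_neg_one {i : K} (hi : i ^ 2 = -1) (a : ℚ_[2]) : algebraMap ℚ_[2] K a ≠ i := by
  intro ha
  have hsq : ‖i - 1‖ ^ 2 = 2⁻¹ := by
    rw [← norm_pow, show (i - 1) ^ 2 = -(2 * i) by rw [sub_sq, hi]; ring, norm_neg, norm_mul, WildDyadic.norm_two,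
      norm_eq_one_of_sq_eq_neg_one hi, mul_one]
  have hi1 : i - 1 = algebraMap ℚ_[2] K (a - 1) := by rw [map_sub, ha, map_one]
  rw [hi1, norm_algebraMap'] at hsq
  by_cases h0 : a - 1 = 0
  · rw [h0, norm_zero, zero_pow two_ne_zero] at hsq
    norm_num at hsq
  · rw [Padic.norm_eq_zpow_neg_valuation h0, ← zpow_natCast, ← zpow_mul, Nat.cast_ofNat,
      show (2 : ℝ)⁻¹ = (2 : ℝ) ^ (-1 : ℤ) by norm_num, Nat.cast_ofNat] at hsq
    have hinj := zpow_right_injective₀ (show (0 : ℝ) < 2 by norm_num) (show (2 : ℝ) ≠ 1 by norm_num) hsq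
    omega

omit [IsUltrametricDist K] [ProperSpace K] in
/-- At `p = 2`, `i² = −1`, degree `2`: `Tr_{K/ℚ₂}(i) = 0`. [cite: SerreLocalFields1979, Ch. III §3] -/
theorem trace_eq_zero_of_sq_eq_neg_one_two {i : K} (hi : i ^ 2 = -1) (hd : finrank ℚ_[2] K = 2) :
    Algebra.trace ℚ_[2] K i = 0 :=
  trace_eq_zero_of_sq_eq_neg_one hi (algebraMap_ne_of_sq_eq_neg_one hi) hd

/-- `(e, f) = (2, 1)` gives `[K : ℚ₂] = 2` (`e·f = [K : ℚ₂]`). [cite: NeukirchANT1999, Ch. II Prop. (6.8)] -/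
theorem finrank_eq_two_of_invariants (he : absRamificationIdx 2 K = 2) (hf : residueDegree 2 K = 1) :
    finrank ℚ_[2] K = 2 := by
  have h := absRamificationIdx_mul_residueDegree 2 K
  rw [he, hf, mul_one] at h
  exact h.symm

include hϖ in
/-- `‖b‖₂ = ‖ϖ‖^{2·v(b)}` for `b ∈ ℚ₂^×` at `e = 2` (`‖2‖ = ‖ϖ‖²`). [cite: NeukirchANT1999, Ch. II Prop. (5.5)] -/
theorem norm_padic_eq_zpow_two_mul (he : absRamificationIdx 2 K = 2) {b : ℚ_[2]} (hb : b ≠ 0) :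
    ‖b‖ = ‖(ϖ : K)‖ ^ (2 * b.valuation) := by
  rw [Padic.norm_eq_zpow_neg_valuation hb, natCast_prime_eq_zpow 2 hϖ, he, ← zpow_mul]
  congr 1
  push_cast
  ring

include hϖ in
/-- **A non-zero trace-zero element of `K ≅ ℚ₂(√−1)` has EVEN `ϖ`-valuation**: `w = b·i`, `‖w‖ = ‖b‖₂ = ‖ϖ‖^{2·v(b)}`.
[cite: SerreLocalFields1979, Ch. III §3] [cite: NeukirchANT1999, Ch. II Prop. (5.5)] -/
theorem norm_eq_zpow_two_mul_of_trace_eq_zero {i : K} (hi : i ^ 2 = -1) (he : absRamificationIdx 2 K = 2)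
    (hf : residueDegree 2 K = 1) {w : K} (hw : Algebra.trace ℚ_[2] K w = 0) (hw0 : w ≠ 0) :
    ∃ k : ℤ, ‖w‖ = ‖(ϖ : K)‖ ^ (2 * k) := by
  obtain ⟨b, rfl, hnorm⟩ :=
    exists_eq_smul_of_trace_eq_zero hi (algebraMap_ne_of_sq_eq_neg_one hi) (finrank_eq_two_of_invariants he hf) hw
  have hb : b ≠ 0 := by rintro rfl; exact hw0 (zero_smul _ i)
  exact ⟨b.valuation, by rw [hnorm, norm_padic_eq_zpow_two_mul hϖ he hb]⟩

include hϖ in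
/-- **Every trace-zero unit logarithm of `K ≅ ℚ₂(√−1)` has `‖w‖ ≤ ‖ϖ‖⁴`** — one shell BELOW the top `‖ϖ‖³` of `log₂(𝒪_K^×) = 𝔪³`
(`logUnits_eq_closedBall_cube_of_sq_eq_neg_one`): `‖w‖ = ‖ϖ‖^{2k} ≤ ‖ϖ‖³` forces `2k ≥ 4`. [cite: NeukirchANT1999, Ch. II Prop. (5.5), (5.7)] -/
theorem norm_le_zpow_four_of_mem_logUnits_of_trace_eq_zero {i : K} (hi : i ^ 2 = -1) (he : absRamificationIdx 2 K = 2)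
    (hf : residueDegree 2 K = 1) {w : K} (hwL : w ∈ logUnits K) (hw : Algebra.trace ℚ_[2] K w = 0) :
    ‖w‖ ≤ ‖(ϖ : K)‖ ^ (4 : ℤ) := by
  have hρ0 : 0 < ‖(ϖ : K)‖ := norm_units_pos ϖ
  by_cases hw0 : w = 0
  · rw [hw0, norm_zero]; exact (zpow_pos hρ0 _).le
  obtain ⟨k, hk⟩ := norm_eq_zpow_two_mul_of_trace_eq_zero hϖ hi he hf hw hw0
  have h3 : ‖w‖ ≤ ‖(ϖ : K)‖ ^ (3 : ℤ) := by
    have h := hwL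
    rw [DyadicNoFixedBall.logUnits_eq_closedBall_cube_of_sq_eq_neg_one hϖ hi he hf, mem_closedBall_zero_iff] at h
    exact_mod_cast h
  rw [hk] at h3 ⊢
  have h3' : (3 : ℤ) ≤ 2 * k := (zpow_le_zpow_iff_right_of_lt_one₀ hρ0 hϖ.1).mp h3
  exact (zpow_le_zpow_iff_right_of_lt_one₀ hρ0 hϖ.1).mpr (by omega)

include hϖ in
/-- `‖ϖ‖⁴ = ‖4‖` at `e = 2`. [cite: NeukirchANT1999, Ch. II Prop. (5.5)] -/
theorem zpow_four_eq_norm_four (he : absRamificationIdx 2 K = 2) : ‖(ϖ : K)‖ ^ (4 : ℤ) = ‖(4 : K)‖ := by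
  have h2 : ‖(ϖ : K)‖ ^ 2 = 2⁻¹ := by
    have h := norm_pow_absRamificationIdx 2 K hϖ
    rw [he] at h
    exact_mod_cast h
  rw [show (4 : K) = 2 * 2 by norm_num, norm_mul, WildDyadic.norm_two, show (4 : ℤ) = ((2 * 2 : ℕ) : ℤ) by norm_num, zpow_natCast,
    pow_mul, h2, sq]

include hϖ in
/-- **The witness `w₀ = 4·i`**: a trace-zero unit logarithm of norm exactly `‖ϖ‖⁴` (`‖4i‖ = ‖4‖ = ‖ϖ‖⁴ ≤ ‖ϖ‖³`, so `4i ∈ 𝔪³ = log₂(𝒪_K^×)`;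
`Tr(4i) = 4·Tr(i) = 0`). [cite: NeukirchANT1999, Ch. II Prop. (5.5)] -/
theorem smul_mem_logUnits_trace_eq_zero_norm_eq {i : K} (hi : i ^ 2 = -1) (he : absRamificationIdx 2 K = 2)
    (hf : residueDegree 2 K = 1) :
    (4 : K) * i ∈ logUnits K ∧ Algebra.trace ℚ_[2] K ((4 : K) * i) = 0 ∧ ‖(4 : K) * i‖ = ‖(ϖ : K)‖ ^ (4 : ℤ) := by
  have hρ0 : 0 < ‖(ϖ : K)‖ := norm_units_pos ϖ
  have hnorm : ‖(4 : K) * i‖ = ‖(ϖ : K)‖ ^ (4 : ℤ) := by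
    rw [norm_mul, norm_eq_one_of_sq_eq_neg_one hi, mul_one, zpow_four_eq_norm_four hϖ he]
  refine ⟨?_, ?_, hnorm⟩
  · rw [DyadicNoFixedBall.logUnits_eq_closedBall_cube_of_sq_eq_neg_one hϖ hi he hf, mem_closedBall_zero_iff, hnorm,
      ← zpow_natCast, Nat.cast_ofNat]
    exact (zpow_le_zpow_iff_right_of_lt_one₀ hρ0 hϖ.1).mpr (by norm_num)
  · rw [show (4 : K) * i = (4 : ℚ_[2]) • i by rw [Algebra.smul_def, map_ofNat], map_smul,
      trace_eq_zero_of_sq_eq_neg_one_two hi (finrank_eq_two_of_invariants he hf), smul_zero]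

include hϖ in
/-- **`log₂(𝒪_K^×) = 𝔪³` attains its maximal norm `‖ϖ‖³`** (at `ϖ³`). [cite: NeukirchANT1999, Ch. II Prop. (5.5)] -/
theorem isGreatest_norm_logUnits {i : K} (hi : i ^ 2 = -1) (he : absRamificationIdx 2 K = 2) (hf : residueDegree 2 K = 1) :
    IsGreatest ((‖·‖) '' logUnits K) (‖(ϖ : K)‖ ^ (3 : ℤ)) := by
  rw [DyadicNoFixedBall.logUnits_eq_closedBall_cube_of_sq_eq_neg_one hϖ hi he hf]
  refine ⟨⟨(ϖ : K) ^ 3, by rw [mem_closedBall_zero_iff, norm_pow], by change ‖(ϖ : K) ^ 3‖ = _; rw [norm_pow, zpow_ofNat]⟩, ?_⟩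
  rintro _ ⟨y, hy, rfl⟩
  rw [mem_closedBall_zero_iff] at hy
  change ‖y‖ ≤ _
  rw [zpow_ofNat]; exact hy

include hϖ in
/-- **The trace-zero part of `log₂(𝒪_K^×)` attains its maximal norm `‖ϖ‖⁴`** (at `4i`) — NOT `‖ϖ‖³`. [cite: NeukirchANT1999, Ch. II Prop. (5.5), (5.7)] -/
theorem isGreatest_norm_logUnits_inter_ker_trace {i : K} (hi : i ^ 2 = -1) (he : absRamificationIdx 2 K = 2)
    (hf : residueDegree 2 K = 1) :
    IsGreatest ((‖·‖) '' (logUnits K ∩ {w | Algebra.trace ℚ_[2] K w = 0})) (‖(ϖ : K)‖ ^ (4 : ℤ)) := by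
  obtain ⟨hL, htr, hnorm⟩ := smul_mem_logUnits_trace_eq_zero_norm_eq hϖ hi he hf
  refine ⟨⟨(4 : K) * i, ⟨hL, htr⟩, hnorm⟩, ?_⟩
  rintro _ ⟨w, ⟨hwL, hw⟩, rfl⟩
  exact norm_le_zpow_four_of_mem_logUnits_of_trace_eq_zero hϖ hi he hf hwL hw

omit [NormedAlgebra ℚ_[2] K] [IsUltrametricDist K] [ProperSpace K] in
include hϖ in
/-- `‖ϖ‖⁴ < ‖ϖ‖³`: the trace-zero shell is STRICTLY below the top. [folklore] -/
private theorem zpow_four_lt_zpow_three : ‖(ϖ : K)‖ ^ (4 : ℤ) < ‖(ϖ : K)‖ ^ (3 : ℤ) :=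
  zpow_lt_zpow_right_of_lt_one₀ (norm_units_pos ϖ) hϖ.1 (by norm_num)

/-- **NOT CO-RADIAL.**  At `K ≅ ℚ₂(√−1)` (`i² = −1`, `(e, f) = (2, 1)`) NO trace-zero unit logarithm has maximal norm in `log₂(𝒪_K^×)`:
every such `w` has `‖w‖ ≤ ‖ϖ‖⁴ < ‖ϖ‖³ = ‖ϖ³‖` with `ϖ³ ∈ log₂(𝒪_K^×)` — the exact negation, at this field, of the conclusion of
`TraceZeroCoradial.exists_mem_logUnits_trace_eq_zero_isMaxOn_of_tame` (which holds at every tame field of degree `≥ 2`).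
[cite: SerreLocalFields1979, Ch. III §3, Prop. 7] [cite: NeukirchANT1999, Ch. II Prop. (5.5), (5.7)] -/
theorem not_exists_mem_logUnits_trace_eq_zero_isMaxOn {i : K} (hi : i ^ 2 = -1) (he : absRamificationIdx 2 K = 2)
    (hf : residueDegree 2 K = 1) :
    ¬ ∃ w ∈ logUnits K, Algebra.trace ℚ_[2] K w = 0 ∧ IsMaxOn (‖·‖) (logUnits K) w := by
  obtain ⟨ϖ, hϖ⟩ := exists_isUniformizer (F := K)
  rintro ⟨w, hwL, hw, hmax⟩
  have h4 := norm_le_zpow_four_of_mem_logUnits_of_trace_eq_zero hϖ hi he hf hwL hw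
  obtain ⟨⟨z, hz, hz3⟩, -⟩ := isGreatest_norm_logUnits hϖ hi he hf
  have hle : ‖z‖ ≤ ‖w‖ := hmax hz
  change ‖z‖ = _ at hz3
  rw [hz3] at hle
  exact absurd (hle.trans h4) (not_le.mpr (zpow_four_lt_zpow_three hϖ))

end Dyadic

end TraceZeroDyadicSqrtNegOne

end Literature.IUT.LogVolume

end
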